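import Summits.BirchSwinnertonDyer.BirchSwinnertonDyer.Theorems.ManinLocalTwoThreeKummerBlindOfSquareOddManin
import Literature.NumberTheory.EllipticCurves.ModTwoReducibleIffTwoTorsionRoot
import Summits.BirchSwinnertonDyer.Rank1Residual.ManinAdditive.KatoShiftTwoLaws
import HarnessLib

/-!
# E-an-53 can only fail where C2 fails: the cuspidal-Kummer odd-exponent law at an ODD Manin constant

Summit `BirchSwinnertonDyer`, route `ManinLocalTwoThree` (cell bsd-f2-manin), deciding crux C2 `ManinOddAtFour` (stmt-BirchSwinnertonDyer-22967),
line `kato_shift_two`, skeleton v10, stub `stub_cuspidalKummerOddExponent` = E-an-53 `CuspidalKummerOddExponent` (a NON-blind rational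
2-torsion point has an ODD `η`-exponent in every cuspidal Kummer representative).  The an planner asserts (MEMO-an §56.5/§56.6) that E-an-53
is C2-EQUIVALENT on its locus: «for `c` odd it is a theorem, so any failure is a curve with `2 ∣ c`».  THIS FILE PROVES THAT:

* `exists_odd_etaExponent_of_not_kummerBlind_of_odd_maninConstant` — under the hypotheses of E-an-53, if `2 ∤ c` then some `r_δ` is odd:
  otherwise `g` is a square in `ℤ₂⟦q⟧` (E-an-49⁺, tree `EtaUnitSquareIffEven_holds`), hence `Ξ_T` is a `2`-adic square (parity of
  `n₁, n₂` from `q`-orders), hence (part 2, `kummerBlindAtTwo_of_isTwoAdicFracSquare_of_odd`) `T` is blind — contradiction;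
* `cuspidalKummerOddExponent_of_maninOddOfReducibleAtFour : ManinOddOfReducibleAtFour → CuspidalKummerOddExponent` — the CONVERSE of
  the line's reduction (lead's `maninOddOfReducibleAtFour_of_cuspidalKummer`, p620942) on its locus: the registered stub is not stronger
  than the crux; a counterexample to E-an-53 is an optimal curve with `4 ∣ N`, a rational 2-torsion point and EVEN Manin constant.

HONEST FRAMING: nothing about BSD, Manin's conjecture or E-an-53 itself is proved; what is proved is `¬`E-an-53 ⟹ `¬`C2-on-the-reducible-locus.
[folklore]
-/

set_option autoImplicit false
set_option linter.dupNamespace false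

noncomputable section

open scoped Classical
open PowerSeries WeierstrassCurve Literature.NumberTheory.EllipticCurves Literature.NumberTheory.EllipticCurves.ModularForms
  Literature.RingTheory.FormalGroups
open Summit.BirchSwinnertonDyer.Rank1Residual.ManinAdditive
open Summit.BirchSwinnertonDyer.Rank1Residual.ManinAdditive.CuspidalKummer

namespace Summit.BirchSwinnertonDyer.BirchSwinnertonDyer.Theorems.ManinLocalTwoThree

section Main

/-- **E-an-53 holds at every datum with ODD Manin constant.**  Under the hypotheses of `CuspidalKummerOddExponent`
(integral newform coefficients, `4 ∣ N`, lattice-optimality not even needed, `a₁ = a₃ = 0` with integer `a₂, a₄`, a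
NON-blind integral root `e`, the germ `z`, a cuspidal Kummer representative `(r, g, A, B)`), if `2 ∤ c` then some
`η`-exponent `r_δ` is odd: otherwise `g` is a square in `ℤ₂⟦q⟧` (E-an-49⁺, tree `EtaUnitSquareIffEven_holds`), hence
`Ξ_T` is a `2`-adic square, hence (`kummerBlindAtTwo_of_isTwoAdicFracSquare_of_odd`) `T` is blind. [folklore] -/
theorem exists_odd_etaExponent_of_not_kummerBlind_of_odd_maninConstant
    (W : WeierstrassCurve ℚ) [W.IsElliptic] [W.IsGloballyMinimal] {N : ℕ} [NeZero N]
    (D : ModularParametrizationData W N) (a : ℕ → ℤ) (ha : ∀ n, (a n : ℂ) = cuspCoeff D.f n)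
    (h4 : 4 ∣ N) (a₂ a₄ e : ℤ) (hW₁ : W.a₁ = 0) (hW₃ : W.a₃ = 0) (hW₂ : W.a₂ = a₂) (hW₄ : W.a₄ = a₄)
    (he : W.twoTorsionPolynomial.toPoly.IsRoot (e : ℚ)) (hnb : ¬ KummerBlindAtTwo a₂ a₄ e)
    (z : ℚ⟦X⟧) (hz : IsParamGerm W D.c a z)
    (r : ℕ → ℤ) (g A B : ℤ⟦X⟧) (hrep : IsCuspidalKummerRep N (kummerSeries W D.c ((e : ℚ)) z) r g A B)
    (hcodd : ¬ (2 : ℤ) ∣ D.c) : ∃ δ ∈ N.divisors, Odd (r δ) := by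
  by_contra hall
  push Not at hall
  have heven : ∀ δ ∈ N.divisors, Even (r δ) := fun δ hδ => Int.not_odd_iff_even.mp (hall δ hδ)
  obtain ⟨-, hEta, hB0, -, n₁, n₂, -, hEq⟩ := hrep
  have h0 : (0 : ℕ) ∉ N.divisors := fun h =>
    (NeZero.ne N) (Nat.eq_zero_of_zero_dvd (Nat.mem_divisors.mp h).1)
  obtain ⟨s, hs'⟩ := (EtaUnitSquareIffEven_holds N.divisors r g h0 hEta).mpr heven
  have hs : PowerSeries.map (Int.castRingHom ℤ_[2]) g = s ^ 2 := by rw [hs', sq]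
  -- `Ξ` is a 2-adic frac-square: `Ξ·B²·qⁿ¹ = qⁿ²·s²·A²`
  apply hnb
  refine kummerBlindAtTwo_of_isTwoAdicFracSquare_of_odd W D a ha h4 a₂ a₄ e hW₁ hW₃ hW₂ hW₄ he z hz hcodd ?_
  set Ξ := kummerSeries W D.c e z with hΞ
  have hcompat : ∀ P : ℤ⟦X⟧, PowerSeries.map (Rat.castHom ℚ_[2]) (PowerSeries.map (Int.castRingHom ℚ) P) =
      PowerSeries.map PadicInt.Coe.ringHom (PowerSeries.map (Int.castRingHom ℤ_[2]) P) := fun P => by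
    rw [map_map_apply, map_map_apply,
      Subsingleton.elim ((Rat.castHom ℚ_[2]).comp (Int.castRingHom ℚ))
        ((PadicInt.Coe.ringHom (p := 2)).comp (Int.castRingHom ℤ_[2]))]
  have hιQinj : Function.Injective (PowerSeries.map (Int.castRingHom ℚ)) :=
    PowerSeries.map_injective _ (RingHom.injective_int _)
  -- parity of `n₁, n₂` from `q`-orders, then assemble the witnesses
  have hΞ0 : constantCoeff Ξ = 1 := by
    rw [hΞ, kummerSeries, map_sub,
      Literature.RingTheory.FormalGroups.constantCoeff_subst_of_constantCoeff_eq_zero hz.1,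
      constantCoeff_formalXMulSq, smul_eq_C_mul, map_mul, map_pow, hz.1]
    simp
  have hΞne : Ξ ≠ 0 := fun h => by rw [h, map_zero] at hΞ0; exact zero_ne_one hΞ0
  have hAne : A ≠ 0 := by
    intro hA
    rw [hA] at hEq
    simp only [zero_pow two_ne_zero, mul_zero, map_zero] at hEq
    rcases mul_eq_zero.mp hEq with h | h
    · rcases mul_eq_zero.mp h with h | h
      · exact hΞne h
      · exact hB0 (hιQinj (by rw [map_zero]; exact (pow_eq_zero_iff two_ne_zero).mp h))
    · exact X_ne_zero ((pow_eq_zero_iff' ).mp h).1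
  -- compare `q`-orders in `ℚ⟦q⟧`: `n₁ + 2 ord B = n₂ + 2 ord A`
  set AQ := PowerSeries.map (Int.castRingHom ℚ) A with hAQ
  set BQ := PowerSeries.map (Int.castRingHom ℚ) B with hBQ
  set gQ := PowerSeries.map (Int.castRingHom ℚ) g with hgQ
  have hAQne : AQ ≠ 0 := fun h => hAne (hιQinj (by rw [map_zero]; exact h))
  have hBQne : BQ ≠ 0 := fun h => hB0 (hιQinj (by rw [map_zero]; exact h))
  have hgU : IsUnit gQ := by
    rw [isUnit_iff_constantCoeff, hgQ, ← coeff_zero_eq_constantCoeff, coeff_map,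
      coeff_zero_eq_constantCoeff, hEta.1, map_one]
    exact isUnit_one
  have hΞU : IsUnit Ξ := by rw [isUnit_iff_constantCoeff, hΞ0]; exact isUnit_one
  have hEqQ : X ^ n₁ * Ξ * BQ ^ 2 = X ^ n₂ * (gQ * AQ ^ 2) := by
    have h := hEq
    simp only [map_mul, map_pow, PowerSeries.map_X] at h
    rw [← hgQ, ← hAQ] at h
    linear_combination h
  have hord := congrArg PowerSeries.order hEqQ
  rw [order_mul, order_mul, order_X_pow, order_zero_of_unit hΞU, add_zero, order_pow, order_mul, order_X_pow,
    order_mul, order_zero_of_unit hgU, zero_add, order_pow, ← coe_toNat_order hBQne,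
    ← coe_toNat_order hAQne] at hord
  set kB := BQ.order.toNat
  set kA := AQ.order.toNat
  have hnat : n₁ + 2 * kB = n₂ + 2 * kA := by
    have : ((n₁ + 2 * kB : ℕ) : ℕ∞) = ((n₂ + 2 * kA : ℕ) : ℕ∞) := by
      push_cast
      simpa [two_nsmul, two_mul] using hord
    exact_mod_cast this
  -- the witnesses in `ℤ₂⟦q⟧`
  set AZ : ℤ_[2]⟦X⟧ := PowerSeries.map (Int.castRingHom ℤ_[2]) A with hAZ
  set BZ : ℤ_[2]⟦X⟧ := PowerSeries.map (Int.castRingHom ℤ_[2]) B with hBZ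
  have hιZinj : Function.Injective (PowerSeries.map (Int.castRingHom ℤ_[2])) :=
    PowerSeries.map_injective _ (RingHom.injective_int _)
  have hBZne : BZ ≠ 0 := fun h => hB0 (hιZinj (by rw [map_zero]; exact h))
  -- mapped equation: `Ξ₂ · (BZ)² · qⁿ¹ = qⁿ² · s² · AZ²`
  have hE1 : PowerSeries.map (Rat.castHom ℚ_[2]) Ξ * PowerSeries.map PadicInt.Coe.ringHom BZ ^ 2 * X ^ n₁ =
      X ^ n₂ * PowerSeries.map PadicInt.Coe.ringHom s ^ 2 * PowerSeries.map PadicInt.Coe.ringHom AZ ^ 2 := by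
    have h := congrArg (PowerSeries.map (Rat.castHom ℚ_[2])) hEq
    simp only [map_mul, map_pow, PowerSeries.map_X, hcompat] at h
    rw [hs, map_pow] at h
    exact h
  rcases le_total n₁ n₂ with hle | hle
  · obtain ⟨m, hm⟩ : ∃ m, n₂ = n₁ + 2 * m := ⟨kB - kA, by omega⟩
    refine ⟨X ^ m * s * AZ, BZ, hBZne, ?_⟩
    have hX : (X : ℚ_[2]⟦X⟧) ^ n₁ ≠ 0 := pow_ne_zero _ X_ne_zero
    apply mul_left_cancel₀ hX
    have h := hE1
    rw [hm, pow_add, pow_mul] at h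
    simp only [map_mul, map_pow, PowerSeries.map_X]
    linear_combination h
  · obtain ⟨m, hm⟩ : ∃ m, n₁ = n₂ + 2 * m := ⟨kA - kB, by omega⟩
    refine ⟨s * AZ, X ^ m * BZ, mul_ne_zero (pow_ne_zero _ X_ne_zero) hBZne, ?_⟩
    have hX : (X : ℚ_[2]⟦X⟧) ^ n₂ ≠ 0 := pow_ne_zero _ X_ne_zero
    apply mul_left_cancel₀ hX
    have h := hE1
    rw [hm, pow_add, pow_mul] at h
    simp only [map_mul, map_pow, PowerSeries.map_X]
    linear_combination h

/-- **The converse of the line's reduction on its locus: `ManinOddOfReducibleAtFour → CuspidalKummerOddExponent`.**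
E-an-53 (v10's `stub_cuspidalKummerOddExponent`) is implied by C2 on the `W[2]`-reducible locus; equivalently a
counterexample to E-an-53 is an optimal curve with `4 ∣ N`, a rational 2-torsion point and EVEN Manin constant.
[folklore] -/
theorem cuspidalKummerOddExponent_of_maninOddOfReducibleAtFour (hC2 : ManinOddOfReducibleAtFour) :
    CuspidalKummerOddExponent := by
  intro W _ _ N _ D a ha h4 hopt a₂ a₄ e hW₁ hW₃ hW₂ hW₄ he hnb z hz r g A B hrep
  have h4' : 2 ^ 2 ∣ N := by norm_num; exact h4
  have hred : ¬ W.HasIrreducibleModPGaloisRep 2 :=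
    W.not_hasIrreducibleModPGaloisRep_two_of_isRoot_twoTorsionPolynomial he
  exact exists_odd_etaExponent_of_not_kummerBlind_of_odd_maninConstant W D a ha h4 a₂ a₄ e hW₁ hW₃ hW₂ hW₄ he hnb
    z hz r g A B hrep (hC2 W D hopt h4' hred)

end Main

end Summit.BirchSwinnertonDyer.BirchSwinnertonDyer.Theorems.ManinLocalTwoThree

end
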